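import Summits.CriticalPhenomena.PercolationContinuityZ3.Theorems.Transplant.SkelSeedSlab
import HarnessLib

/-!
# L5.5b v2 — the INTERIOR seed slab of a window level: the slab's cylinder is kept off the boundary layer of the box (centre `ℓs + 1`
# inward, two inward `step`s lead from the contact's inner neighbour into it), so that the Step-V shell may contain the far faces `{y}`
# (lane INBOX 2026-08-20 p1-g7 20:12Z; supersedes the geometry of `SkelSeedSlab` (v1), whose slab touches the boundary layer)

builds on p205010 (kernel theorem, internal audit signed; external expert review pending) — nothing in this file uses p205010.
Lane `prim-bschramm`, seat `prim-bschramm-p1` (gen 7); helper file (`--supports stmt-CriticalPhenomena-4575 --as helper`); namespace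
`Transplant.SkelI`, `[DecidableEq V]` binder.

WHY v2.  Kozma–Nitzan's Step V (`KNLevels.LHyp.stepV`) needs every face inside the shell `S` (`hUS`, the good face vertex becomes a relay
in `A ⊆ S`) and every seed off `wireSet S` (`hSseed`).  A FAR contact (inner neighbour `y` with `fd y > R − r₀`) has no in-ball inward
move, so its face is `{y}` (edge-contact remedy) and `S ⊇ Yfar :=` the far inner neighbours — vertices of the BOUNDARY LAYER
`φ ∉ Icc (Lo+1) (Hi−1)`.  The v1 slab `cylBallFin (slabCtr Lo Hi ℓs y) ℓs R′` spans planar depths `[0, 2ℓs]` and may contain two adjacent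
far inner neighbours (a seed edge inside `wireSet S`).  Here the near region is
  `S x := {y, y₁, y₂} ∪ cylBallFin (slabCtr Lo Hi (ℓs+1) y) ℓs R′`,
`y₁ = inward y 0`, `y₂ = inward y₁ 1` the coordinatewise inward `step`s (`φ y₂ = slabPt Lo Hi 1 (φ y)`, the clamp into the interior box),
and the cylinder `φ⁻¹(φ t + Λ_{ℓs})`, `φ t = slabPt Lo Hi (ℓs+1) (φ y)`, lies in the INTERIOR box `Icc (Lo+1) (Hi−1)` and below planar
depth `2ℓs + 2` in the exit coordinate: every seed edge keeps an endpoint OFF any `T ⊆ B⟨j⟩` made of shell vertices (`φ ∈ Icc (Lo+2ℓs+2)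
(Hi−2ℓs−2)`) and far boundary-layer vertices (`slabSeedIn_notMem_wireSet`).  Constants: cube near face at depth `2ℓs + 2` (p3-g4's
`SkelCubeAt` with `t := slabCtr Lo Hi (ℓs+1) y`), box sides `≥ 2ℓs + 2`, `R′` with `B_G(c, 2ℓs+4) ∩ cyl c ℓs ⊆ cylBall c ℓs R′`,
`2ℓs + 2 + R′ ≤ r₀ ≤ R`, `rs ≥ 2ℓs + 3 + R′`.
* §1 `inward`, `inward_spec`; §2 `slabGeomIn`, `NearFaceOKIn`, **`kitOK_slabIn`** (`SkelI.KitOK … ((Φ.Δ+1)^R′ + 3) cU (slabGeomIn …)`);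
  (Step V's `hSseed` for `S = shell ∪ far faces` is `SkelSeedSlabInAvoid.slabSeedIn_notMem_wireSet`).
[cite: KozmaNitzan2024, §4 Lemma 10, p. 19 (Step III), p. 21 (U(P), "Q ⊆ S"), pp. 21–22 (Step V)] [cite: GrimmettPercolation1999, §7.2]
-/

noncomputable section

open scoped Classical

namespace Summit.CriticalPhenomena.PercolationContinuityZ3.Theorems

namespace Transplant

namespace SkelI

open Literature.Probability.Percolation Literature.Probability.LatticeModels SimpleGraph KNLevels
open Literature.Barriers.CriticalPhenomena (graphBall graphBall_finite mem_graphBall_self graphBall_mono)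
open BoxProdZ2 (ballFin mem_ballFin card_ballFin_le)
open Skel (winGraph winGraph_adj winLevel mem_winLevel_iff winLevel_monotone winLevel_subset_graphBall winLData winLData_X inNbr KitGeom
  cylBallFin mem_cylBallFin pathIn_cylBall' cylBall_subset_cyl)

variable {V : Type} {G : SimpleGraph V} [G.LocallyFinite] (Φ : PlanarSkeletonConc G)

/-! ## §1 The inward step in one coordinate -/

/-- **One inward step in coordinate `i`** off the boundary layer of the box: from the face `φ v i = Lo i` (resp. `Hi i`) a `step`-neighbour
with `φ` moved by `+e_i` (resp. `−e_i`); elsewhere `v` itself. [cite: KozmaNitzan2024, §4 p. 21 (v(P))] -/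
def inward (Lo Hi : Site 2) (i : Fin 2) (v : V) : V :=
  if Φ.φ v i = Lo i then Classical.choose (Φ.step v i 1)
  else if Φ.φ v i = Hi i then Classical.choose (Φ.step v i (-1)) else v

/-- Specification of the inward step (box side `≥ 2` in coordinate `i`, `φ v` in the box): it is `v` or a neighbour of `v`, and its
skeleton coordinate is `φ v` with the `i`-th entry clamped into `[Lo i + 1, Hi i − 1]` (the other entry unchanged). [folklore] -/
theorem inward_spec {Lo Hi : Site 2} (i : Fin 2) (hw : Lo i + 2 ≤ Hi i) {v : V} (hv : Φ.φ v ∈ Finset.Icc Lo Hi) :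
    (inward Φ Lo Hi i v = v ∨ G.Adj v (inward Φ Lo Hi i v)) ∧
      Φ.φ (inward Φ Lo Hi i v) i = slabPt Lo Hi 1 (Φ.φ v) i ∧ ∀ k, k ≠ i → Φ.φ (inward Φ Lo Hi i v) k = Φ.φ v k := by
  rw [Finset.mem_Icc] at hv
  have h1 : Lo i ≤ Φ.φ v i := hv.1 i
  have h2 : Φ.φ v i ≤ Hi i := hv.2 i
  unfold inward
  by_cases hlo : Φ.φ v i = Lo i
  · rw [if_pos hlo]
    obtain ⟨hadj, hφ⟩ := Classical.choose_spec (Φ.step v i 1)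
    refine ⟨Or.inr hadj, ?_, fun k hk => ?_⟩
    · rw [hφ]; simp only [Pi.add_apply, Pi.single_eq_same, Units.val_one, slabPt, max_def, min_def, Nat.cast_one]
      split_ifs <;> omega
    · rw [hφ]; simp [Pi.single_eq_of_ne hk]
  · rw [if_neg hlo]
    by_cases hhi : Φ.φ v i = Hi i
    · rw [if_pos hhi]
      obtain ⟨hadj, hφ⟩ := Classical.choose_spec (Φ.step v i (-1))
      refine ⟨Or.inr hadj, ?_, fun k hk => ?_⟩
      · rw [hφ]; simp only [Pi.add_apply, Pi.single_eq_same, Units.val_neg, Units.val_one, slabPt, max_def, min_def, Nat.cast_one]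
        split_ifs <;> omega
      · rw [hφ]; simp [Pi.single_eq_of_ne hk]
    · rw [if_neg hhi]
      refine ⟨Or.inl rfl, ?_, fun k _ => rfl⟩
      simp only [slabPt, max_def, min_def, Nat.cast_one]
      split_ifs <;> omega

/-- The two inward steps land over the interior clamp `slabPt Lo Hi 1 (φ y)` (box sides `≥ 2`). [folklore] -/
theorem φ_inward_inward {Lo Hi : Site 2} (hw : ∀ i, Lo i + 2 ≤ Hi i) {y : V} (hy : Φ.φ y ∈ Finset.Icc Lo Hi) :
    Φ.φ (inward Φ Lo Hi 1 (inward Φ Lo Hi 0 y)) = slabPt Lo Hi 1 (Φ.φ y) := by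
  obtain ⟨-, h0i, h0k⟩ := inward_spec Φ 0 (hw 0) hy
  have hy1 : Φ.φ (inward Φ Lo Hi 0 y) ∈ Finset.Icc Lo Hi := by
    rw [Finset.mem_Icc] at hy ⊢
    have ha : slabPt Lo Hi 1 (Φ.φ y) 0 ≤ Hi 0 ∧ Lo 0 ≤ slabPt Lo Hi 1 (Φ.φ y) 0 := by
      have := hw 0; simp only [slabPt, max_def, min_def, Nat.cast_one]; split_ifs <;> constructor <;> omega
    constructor <;> intro k
    · by_cases hk : k = 0
      · subst hk; rw [h0i]; exact ha.2
      · rw [h0k k hk]; exact hy.1 k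
    · by_cases hk : k = 0
      · subst hk; rw [h0i]; exact ha.1
      · rw [h0k k hk]; exact hy.2 k
  obtain ⟨-, h1i, h1k⟩ := inward_spec Φ 1 (hw 1) hy1
  funext k
  fin_cases k
  · show Φ.φ (inward Φ Lo Hi 1 (inward Φ Lo Hi 0 y)) 0 = slabPt Lo Hi 1 (Φ.φ y) 0
    rw [h1k 0 (by decide), h0i]
  · show Φ.φ (inward Φ Lo Hi 1 (inward Φ Lo Hi 0 y)) 1 = slabPt Lo Hi 1 (Φ.φ y) 1
    rw [h1i]
    -- `slabPt … 1 (φ y₁) 1 = slabPt … 1 (φ y) 1` since coordinate `1` is untouched by the first step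
    simp only [slabPt, h0k 1 (by decide)]

/-- The interior clamp and the slab clamp differ by at most `ℓs` in each coordinate (box sides `≥ 2ℓs + 2`). [folklore] -/
theorem abs_slabPt_one_sub_slabPt_le {Lo Hi : Site 2} {ℓs : ℕ} (hwide : ∀ i, Lo i + 2 * (ℓs + 1) ≤ Hi i) {z : Site 2}
    (hz : z ∈ Finset.Icc Lo Hi) (i : Fin 2) : |slabPt Lo Hi 1 z i - slabPt Lo Hi (ℓs + 1) z i| ≤ ℓs := by
  rw [Finset.mem_Icc] at hz
  have h1 : Lo i ≤ z i := hz.1 i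
  have h2 : z i ≤ Hi i := hz.2 i
  have h3 := hwide i
  simp only [slabPt, max_def, min_def, Nat.cast_one, Nat.cast_add]
  rw [abs_le]
  split_ifs <;> constructor <;> omega

/-- The slab clamp with offset `ℓs + 1` keeps the box of half-width `ℓs` inside the INTERIOR box `Icc (Lo+1) (Hi−1)`. [folklore] -/
theorem add_mem_Icc_interior_of_mem_box {Lo Hi : Site 2} {ℓs : ℕ} (hwide : ∀ i, Lo i + 2 * (ℓs + 1) ≤ Hi i) (z : Site 2) {b : Site 2}
    (hb : b ∈ box 2 ℓs) : slabPt Lo Hi (ℓs + 1) z + b ∈ Finset.Icc (Lo + 1) (Hi - 1) := by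
  rw [mem_box] at hb
  rw [Finset.mem_Icc]
  constructor <;> intro i <;> have hbi := hb i <;> have h3 := hwide i <;>
    simp only [Pi.add_apply, Pi.sub_apply, Pi.one_apply, slabPt, max_def, min_def, Nat.cast_add, Nat.cast_one] <;>
    split_ifs <;> omega

variable [DecidableEq V]

/-! ## §2 The interior slab geometry and the kit hypotheses -/

/-- **The interior slab geometry** of the window level `j` (`Lo = lo − j`, `Hi = hi + j`): `y = inNbr`; NEAR contact (`y ∈ B_G(w₀, R − r₀)`):
region `{y, y₁, y₂} ∪ cylBallFin (slabCtr Lo Hi (ℓs+1) y) ℓs R′` (`y₁ = inward y 0`, `y₂ = inward y₁ 1`), face `Unear x`; FAR contact: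
region and face `{y}`. [cite: KozmaNitzan2024, §4 p. 19 (seeds)] -/
def slabGeomIn (w₀ : V) (R : ℕ) (lo hi : Site 2) (j ℓs R' r₀ : ℕ) (Unear : V → Finset V) : KitGeom V where
  y := inNbr Φ w₀ R (Finset.Icc (lo - (j : Site 2)) (hi + (j : Site 2)))
  S := fun x =>
    if inNbr Φ w₀ R (Finset.Icc (lo - (j : Site 2)) (hi + (j : Site 2))) x ∈ graphBall G w₀ (R - r₀) then
      {inNbr Φ w₀ R (Finset.Icc (lo - (j : Site 2)) (hi + (j : Site 2))) x,
        inward Φ (lo - (j : Site 2)) (hi + (j : Site 2)) 0 (inNbr Φ w₀ R (Finset.Icc (lo - (j : Site 2)) (hi + (j : Site 2))) x),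
        inward Φ (lo - (j : Site 2)) (hi + (j : Site 2)) 1
          (inward Φ (lo - (j : Site 2)) (hi + (j : Site 2)) 0 (inNbr Φ w₀ R (Finset.Icc (lo - (j : Site 2)) (hi + (j : Site 2))) x))} ∪
      cylBallFin Φ (slabCtr Φ (lo - (j : Site 2)) (hi + (j : Site 2)) (ℓs + 1)
        (inNbr Φ w₀ R (Finset.Icc (lo - (j : Site 2)) (hi + (j : Site 2))) x)) ℓs R'
    else {inNbr Φ w₀ R (Finset.Icc (lo - (j : Site 2)) (hi + (j : Site 2))) x}
  U := fun x =>
    if inNbr Φ w₀ R (Finset.Icc (lo - (j : Site 2)) (hi + (j : Site 2))) x ∈ graphBall G w₀ (R - r₀) then Unear x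
    else {inNbr Φ w₀ R (Finset.Icc (lo - (j : Site 2)) (hi + (j : Site 2))) x}

/-- **The face conditions of a near contact, interior slab**: the face lies in `B⟨j⟩` and in `B_G(x, rs)`, each face vertex has a
`G`-neighbour in the cylinder ball `cylBall (slabCtr Lo Hi (ℓs+1) y) ℓs R′`, at most `cU` vertices. [cite: KozmaNitzan2024, §4 p. 21 (U(P))] -/
structure NearFaceOKIn (w₀ : V) (R : ℕ) (lo hi : Site 2) (j ℓs R' r₀ rs cU : ℕ) (Unear : V → Finset V) : Prop where
  sub : ∀ x ∈ outerBoundary (winGraph G w₀ R) (winLevel Φ w₀ R lo hi j),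
    inNbr Φ w₀ R (Finset.Icc (lo - (j : Site 2)) (hi + (j : Site 2))) x ∈ graphBall G w₀ (R - r₀) → Unear x ⊆ winLevel Φ w₀ R lo hi j
  ball : ∀ x ∈ outerBoundary (winGraph G w₀ R) (winLevel Φ w₀ R lo hi j),
    inNbr Φ w₀ R (Finset.Icc (lo - (j : Site 2)) (hi + (j : Site 2))) x ∈ graphBall G w₀ (R - r₀) → ∀ u ∈ Unear x, u ∈ graphBall G x rs
  adj : ∀ x ∈ outerBoundary (winGraph G w₀ R) (winLevel Φ w₀ R lo hi j),
    inNbr Φ w₀ R (Finset.Icc (lo - (j : Site 2)) (hi + (j : Site 2))) x ∈ graphBall G w₀ (R - r₀) → ∀ u ∈ Unear x,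
      ∃ v ∈ Φ.cylBall (slabCtr Φ (lo - (j : Site 2)) (hi + (j : Site 2)) (ℓs + 1)
        (inNbr Φ w₀ R (Finset.Icc (lo - (j : Site 2)) (hi + (j : Site 2))) x)) ℓs R', G.Adj v u
  card : ∀ x ∈ outerBoundary (winGraph G w₀ R) (winLevel Φ w₀ R lo hi j),
    inNbr Φ w₀ R (Finset.Icc (lo - (j : Site 2)) (hi + (j : Site 2))) x ∈ graphBall G w₀ (R - r₀) → (Unear x).card ≤ cU
  one_le : 1 ≤ cU

/-- **The interior slab geometry satisfies `KitOK`** with region size `(Δ+1)^{R′} + 3` and reach `rs`, provided every side of the box is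
`≥ 2ℓs + 2`, `B_G(c, 2ℓs+4) ∩ cyl c ℓs ⊆ cylBall c ℓs R′` at every centre, `2ℓs + 2 + R′ ≤ r₀ ≤ R`, `2ℓs + 3 + R′ ≤ rs`, and the near faces
satisfy `NearFaceOKIn`. [cite: KozmaNitzan2024, §4 p. 19 (Step III)] -/
theorem kitOK_slabIn {w₀ : V} {R : ℕ} {lo hi : Site 2} {j ℓs R' r₀ rs cU : ℕ} {Unear : V → Finset V}
    (hwide : ∀ i, (lo - (j : Site 2)) i + 2 * (ℓs + 1) ≤ (hi + (j : Site 2)) i)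
    (hR' : ∀ c : V, graphBall G c (2 * ℓs + 4) ∩ Φ.toPlanarSkeleton.cyl c ℓs ⊆ Φ.cylBall c ℓs R')
    (hr₀ : 2 * ℓs + 2 + R' ≤ r₀) (hR : r₀ ≤ R) (hrs : 2 * ℓs + 3 + R' ≤ rs) (hU : NearFaceOKIn Φ w₀ R lo hi j ℓs R' r₀ rs cU Unear) :
    KitOK Φ w₀ R lo hi j rs ((Φ.Δ + 1) ^ R' + 3) cU (slabGeomIn Φ w₀ R lo hi j ℓs R' r₀ Unear) := by
  set K := outerBoundary (winGraph G w₀ R) (winLevel Φ w₀ R lo hi j) with hK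
  have hKeq : winLevel Φ w₀ R lo hi j = Φ.Win w₀ (Finset.Icc (lo - (j : Site 2)) (hi + (j : Site 2))) R := rfl
  have hw2 : ∀ i, (lo - (j : Site 2)) i + 2 ≤ (hi + (j : Site 2)) i := fun i => by have := hwide i; omega
  -- the inner neighbour
  have hy : ∀ x ∈ K, G.Adj x (inNbr Φ w₀ R (Finset.Icc (lo - (j : Site 2)) (hi + (j : Site 2))) x) ∧ inNbr Φ w₀ R (Finset.Icc (lo - (j : Site 2)) (hi + (j : Site 2))) x ∈ graphBall G w₀ R ∧
      Φ.φ (inNbr Φ w₀ R (Finset.Icc (lo - (j : Site 2)) (hi + (j : Site 2))) x) ∈ Finset.Icc (lo - (j : Site 2)) (hi + (j : Site 2)) := fun x hx => inNbr_spec Φ (by rwa [hK, hKeq] at hx)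
  -- the two inward steps: adjacency-or-equality, coordinates, membership in the box and in the ball
  have hst1 : ∀ x ∈ K, (inward Φ (lo - (j : Site 2)) (hi + (j : Site 2)) 0 (inNbr Φ w₀ R (Finset.Icc (lo - (j : Site 2)) (hi + (j : Site 2))) x) = inNbr Φ w₀ R (Finset.Icc (lo - (j : Site 2)) (hi + (j : Site 2))) x ∨
      G.Adj (inNbr Φ w₀ R (Finset.Icc (lo - (j : Site 2)) (hi + (j : Site 2))) x) (inward Φ (lo - (j : Site 2)) (hi + (j : Site 2)) 0 (inNbr Φ w₀ R (Finset.Icc (lo - (j : Site 2)) (hi + (j : Site 2))) x))) ∧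
      Φ.φ (inward Φ (lo - (j : Site 2)) (hi + (j : Site 2)) 0 (inNbr Φ w₀ R (Finset.Icc (lo - (j : Site 2)) (hi + (j : Site 2))) x)) ∈ Finset.Icc (lo - (j : Site 2)) (hi + (j : Site 2)) := by
    intro x hx
    obtain ⟨h, hφi, hφk⟩ := inward_spec Φ 0 (hw2 0) (hy x hx).2.2
    refine ⟨h, ?_⟩
    have hyb := (hy x hx).2.2
    rw [Finset.mem_Icc] at hyb ⊢
    have ha : (lo - (j : Site 2)) 0 ≤ slabPt (lo - (j : Site 2)) (hi + (j : Site 2)) 1 (Φ.φ (inNbr Φ w₀ R (Finset.Icc (lo - (j : Site 2)) (hi + (j : Site 2))) x)) 0 ∧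
        slabPt (lo - (j : Site 2)) (hi + (j : Site 2)) 1 (Φ.φ (inNbr Φ w₀ R (Finset.Icc (lo - (j : Site 2)) (hi + (j : Site 2))) x)) 0 ≤ (hi + (j : Site 2)) 0 := by
      have := hw2 0; simp only [slabPt, max_def, min_def, Nat.cast_one]; split_ifs <;> constructor <;> omega
    constructor <;> intro k
    · by_cases hk0 : k = 0
      · subst hk0; rw [hφi]; exact ha.1
      · rw [hφk k hk0]; exact hyb.1 k
    · by_cases hk0 : k = 0
      · subst hk0; rw [hφi]; exact ha.2
      · rw [hφk k hk0]; exact hyb.2 k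
  have hst2 : ∀ x ∈ K, (inward Φ (lo - (j : Site 2)) (hi + (j : Site 2)) 1 (inward Φ (lo - (j : Site 2)) (hi + (j : Site 2)) 0 (inNbr Φ w₀ R (Finset.Icc (lo - (j : Site 2)) (hi + (j : Site 2))) x)) =
        inward Φ (lo - (j : Site 2)) (hi + (j : Site 2)) 0 (inNbr Φ w₀ R (Finset.Icc (lo - (j : Site 2)) (hi + (j : Site 2))) x) ∨
      G.Adj (inward Φ (lo - (j : Site 2)) (hi + (j : Site 2)) 0 (inNbr Φ w₀ R (Finset.Icc (lo - (j : Site 2)) (hi + (j : Site 2))) x))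
        (inward Φ (lo - (j : Site 2)) (hi + (j : Site 2)) 1 (inward Φ (lo - (j : Site 2)) (hi + (j : Site 2)) 0 (inNbr Φ w₀ R (Finset.Icc (lo - (j : Site 2)) (hi + (j : Site 2))) x)))) ∧
      Φ.φ (inward Φ (lo - (j : Site 2)) (hi + (j : Site 2)) 1 (inward Φ (lo - (j : Site 2)) (hi + (j : Site 2)) 0 (inNbr Φ w₀ R (Finset.Icc (lo - (j : Site 2)) (hi + (j : Site 2))) x))) = slabPt (lo - (j : Site 2)) (hi + (j : Site 2)) 1 (Φ.φ (inNbr Φ w₀ R (Finset.Icc (lo - (j : Site 2)) (hi + (j : Site 2))) x)) :=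
    fun x hx => ⟨(inward_spec Φ 1 (hw2 1) (hst1 x hx).2).1, φ_inward_inward Φ hw2 (hy x hx).2.2⟩
  -- abbreviations for the path vertices and the slab centre
  set yv : V → V := fun x => inNbr Φ w₀ R (Finset.Icc (lo - (j : Site 2)) (hi + (j : Site 2))) x with hyv
  set y1 : V → V := fun x => inward Φ (lo - (j : Site 2)) (hi + (j : Site 2)) 0 (yv x) with hy1
  set y2 : V → V := fun x => inward Φ (lo - (j : Site 2)) (hi + (j : Site 2)) 1 (y1 x) with hy2
  set tc : V → V := fun x => slabCtr Φ (lo - (j : Site 2)) (hi + (j : Site 2)) (ℓs + 1) (yv x) with htc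
  -- graph-ball bookkeeping of the path
  have hy1ball : ∀ x ∈ K, y1 x ∈ graphBall G (yv x) 1 := by
    intro x hx
    rcases (hst1 x hx).1 with h | h
    · simp only [hy1]; rw [h]; exact mem_graphBall_self G _ 1
    · exact BoxProdZ2.mem_graphBall_succ_of_adj G (mem_graphBall_self G _ 0) h
  have hy2ball : ∀ x ∈ K, y2 x ∈ graphBall G (yv x) 2 := by
    intro x hx
    rcases (hst2 x hx).1 with h | h
    · simp only [hy2, hy1] at h ⊢; rw [h]; exact graphBall_mono G _ (by norm_num) (hy1ball x hx)
    · exact BoxProdZ2.mem_graphBall_succ_of_adj G (hy1ball x hx) h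
  -- `y₂` lies in the slab's cylinder ball
  have hy2cyl : ∀ x ∈ K, y2 x ∈ Φ.cylBall (tc x) ℓs R' := by
    intro x hx
    refine hR' _ ⟨?_, ?_⟩
    · have h1 := (slabCtr_spec Φ hwide (hy x hx).2.2).1
      have h2 := BoxProdZ2.mem_graphBall_add G ((BoxProdZ2.mem_graphBall_comm G).1 h1) (hy2ball x hx)
      exact graphBall_mono G _ (by ring_nf; omega) h2
    · rw [PlanarSkeleton.mem_cyl, (slabCtr_spec Φ hwide (hy x hx).2.2).2, (hst2 x hx).2, mem_box]
      intro i
      have h := abs_slabPt_one_sub_slabPt_le hwide (hy x hx).2.2 i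
      rw [abs_le] at h
      simp only [Pi.sub_apply]
      exact ⟨h.1, h.2⟩
  -- the slab: inside the level, near the contact, small
  have hslab_sub : ∀ x ∈ K, yv x ∈ graphBall G w₀ (R - r₀) → ∀ v ∈ Φ.cylBall (tc x) ℓs R', v ∈ winLevel Φ w₀ R lo hi j := by
    intro x hx hnear v hv
    rw [mem_winLevel_iff]
    have hcyl := cylBall_subset_cyl Φ _ ℓs R' hv
    rw [PlanarSkeleton.mem_cyl, (slabCtr_spec Φ hwide (hy x hx).2.2).2] at hcyl
    have hin := add_mem_Icc_interior_of_mem_box hwide (Φ.φ (yv x)) hcyl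
    rw [add_sub_cancel] at hin
    refine ⟨?_, Finset.Icc_subset_Icc (fun i => ?_) (fun i => ?_) hin⟩
    · have h1 : v ∈ graphBall G (tc x) R' := (Φ.cylBall_subset_prism _ ℓs R' hv).1
      have h2 := (slabCtr_spec Φ hwide (hy x hx).2.2).1
      have h3 := BoxProdZ2.mem_graphBall_add G (BoxProdZ2.mem_graphBall_add G hnear h2) h1
      refine graphBall_mono G w₀ ?_ h3
      have : R - r₀ + 2 * (ℓs + 1) + R' ≤ R := by omega
      simpa [two_mul, add_assoc, add_comm, add_left_comm] using this
    · simp only [Pi.add_apply, Pi.one_apply]; omega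
    · simp only [Pi.sub_apply, Pi.one_apply]; omega
  have hslab_ball : ∀ x ∈ K, ∀ v ∈ Φ.cylBall (tc x) ℓs R', v ∈ graphBall G x rs := by
    intro x hx v hv
    have h1 : v ∈ graphBall G (tc x) R' := (Φ.cylBall_subset_prism _ ℓs R' hv).1
    have h2 := (slabCtr_spec Φ hwide (hy x hx).2.2).1
    have h0 : yv x ∈ graphBall G x 1 := BoxProdZ2.mem_graphBall_succ_of_adj G (mem_graphBall_self G x 0) (hy x hx).1
    have h3 := BoxProdZ2.mem_graphBall_add G (BoxProdZ2.mem_graphBall_add G h0 h2) h1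
    refine graphBall_mono G x ?_ h3
    have : 1 + 2 * (ℓs + 1) + R' ≤ rs := by omega
    simpa [two_mul, add_assoc, add_comm, add_left_comm] using this
  have hpath_level : ∀ x ∈ K, yv x ∈ graphBall G w₀ (R - r₀) →
      yv x ∈ winLevel Φ w₀ R lo hi j ∧ y1 x ∈ winLevel Φ w₀ R lo hi j ∧ y2 x ∈ winLevel Φ w₀ R lo hi j := by
    intro x hx hnear
    refine ⟨(mem_winLevel_iff Φ).2 ⟨(hy x hx).2.1, (hy x hx).2.2⟩, (mem_winLevel_iff Φ).2 ⟨?_, (hst1 x hx).2⟩,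
      (mem_winLevel_iff Φ).2 ⟨?_, ?_⟩⟩
    · exact graphBall_mono G w₀ (by omega) (BoxProdZ2.mem_graphBall_add G hnear (hy1ball x hx))
    · exact graphBall_mono G w₀ (by omega) (BoxProdZ2.mem_graphBall_add G hnear (hy2ball x hx))
    · rw [(hst2 x hx).2]
      have h := add_mem_Icc_of_mem_box_slabPt (Lo := (lo - (j : Site 2))) (Hi := (hi + (j : Site 2))) (ℓ := 1)
        (fun i => by have := hw2 i; omega) (Φ.φ (yv x)) (zero_mem_box 2 1)
      rwa [add_zero] at h
  have hpath_ball : ∀ x ∈ K, yv x ∈ graphBall G x rs ∧ y1 x ∈ graphBall G x rs ∧ y2 x ∈ graphBall G x rs := by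
    intro x hx
    have h0 : yv x ∈ graphBall G x 1 := BoxProdZ2.mem_graphBall_succ_of_adj G (mem_graphBall_self G x 0) (hy x hx).1
    exact ⟨graphBall_mono G x (by omega) h0, graphBall_mono G x (by omega) (BoxProdZ2.mem_graphBall_add G h0 (hy1ball x hx)),
      graphBall_mono G x (by omega) (BoxProdZ2.mem_graphBall_add G h0 (hy2ball x hx))⟩
  -- paths inside the near region
  have hpath : ∀ x ∈ K, ∀ v ∈ ({yv x, y1 x, y2 x} ∪ cylBallFin Φ (tc x) ℓs R' : Finset V),
      PathIn G (↑({yv x, y1 x, y2 x} ∪ cylBallFin Φ (tc x) ℓs R' : Finset V) : Set V) (yv x) v := by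
    intro x hx v hv
    set A : Finset V := {yv x, y1 x, y2 x} ∪ cylBallFin Φ (tc x) ℓs R' with hA
    have hAy : yv x ∈ (↑A : Set V) := by simp [hA]
    have hA1 : y1 x ∈ (↑A : Set V) := by simp [hA]
    have hA2 : y2 x ∈ (↑A : Set V) := by simp [hA]
    have hAc : Φ.cylBall (tc x) ℓs R' ⊆ (↑A : Set V) := by
      intro u hu; simp only [hA, Finset.coe_union, Set.mem_union]; exact Or.inr (by rw [Finset.mem_coe, mem_cylBallFin]; exact hu)
    have p1 : PathIn G (↑A : Set V) (yv x) (y1 x) := by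
      rcases (hst1 x hx).1 with h | h
      · simp only [hy1]; rw [h]; exact PathIn.refl hAy
      · exact PathIn.of_adj hAy hA1 h
    have p2 : PathIn G (↑A : Set V) (yv x) (y2 x) := by
      rcases (hst2 x hx).1 with h | h
      · simp only [hy2, hy1] at h ⊢; rw [h]; exact p1
      · exact p1.tail h hA2
    rw [hA, Finset.mem_union] at hv
    rcases hv with hv | hv
    · simp only [Finset.mem_insert, Finset.mem_singleton] at hv
      rcases hv with rfl | rfl | rfl
      · exact PathIn.refl hAy
      · exact p1
      · exact p2
    · exact p2.trans ((pathIn_cylBall' Φ (hy2cyl x hx) ((mem_cylBallFin Φ).1 hv)).mono hAc)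
  refine ⟨fun x hx => (hy x hx).1, fun x hx => ?_, fun x hx => ?_, fun x hx => ?_, fun x hx => ?_, fun x hx => ?_, fun x hx => ?_,
    fun x hx => ?_, fun x hx => ?_, fun x hx => ?_⟩
  · -- y_mem
    show yv x ∈ (slabGeomIn Φ w₀ R lo hi j ℓs R' r₀ Unear).S x
    simp only [slabGeomIn]
    split_ifs with hnear
    · exact Finset.mem_union_left _ (by simp [hyv])
    · exact Finset.mem_singleton_self _
  · -- S_sub
    show (slabGeomIn Φ w₀ R lo hi j ℓs R' r₀ Unear).S x ⊆ winLevel Φ w₀ R lo hi j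
    simp only [slabGeomIn]
    split_ifs with hnear
    · intro v hv
      rw [Finset.mem_union] at hv
      rcases hv with hv | hv
      · simp only [Finset.mem_insert, Finset.mem_singleton] at hv
        obtain ⟨h0, h1, h2⟩ := hpath_level x hx hnear
        rcases hv with rfl | rfl | rfl
        · exact h0
        · exact h1
        · exact h2
      · exact hslab_sub x hx hnear v ((mem_cylBallFin Φ).1 hv)
    · intro v hv; rw [Finset.mem_singleton] at hv; rw [hv]
      exact (mem_winLevel_iff Φ).2 ⟨(hy x hx).2.1, (hy x hx).2.2⟩
  · -- U_sub
    show (slabGeomIn Φ w₀ R lo hi j ℓs R' r₀ Unear).U x ⊆ winLevel Φ w₀ R lo hi j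
    simp only [slabGeomIn]
    split_ifs with hnear
    · exact hU.sub x hx hnear
    · intro v hv; rw [Finset.mem_singleton] at hv; rw [hv]
      exact (mem_winLevel_iff Φ).2 ⟨(hy x hx).2.1, (hy x hx).2.2⟩
  · -- S_ball
    show ∀ v ∈ (slabGeomIn Φ w₀ R lo hi j ℓs R' r₀ Unear).S x, v ∈ graphBall G x rs
    simp only [slabGeomIn]
    split_ifs with hnear
    · intro v hv
      rw [Finset.mem_union] at hv
      rcases hv with hv | hv
      · simp only [Finset.mem_insert, Finset.mem_singleton] at hv
        obtain ⟨h0, h1, h2⟩ := hpath_ball x hx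
        rcases hv with rfl | rfl | rfl
        · exact h0
        · exact h1
        · exact h2
      · exact hslab_ball x hx v ((mem_cylBallFin Φ).1 hv)
    · intro v hv; rw [Finset.mem_singleton] at hv; rw [hv]; exact (hpath_ball x hx).1
  · -- U_ball
    show ∀ u ∈ (slabGeomIn Φ w₀ R lo hi j ℓs R' r₀ Unear).U x, u ∈ graphBall G x rs
    simp only [slabGeomIn]
    split_ifs with hnear
    · exact hU.ball x hx hnear
    · intro v hv; rw [Finset.mem_singleton] at hv; rw [hv]; exact (hpath_ball x hx).1
  · -- S_path
    show ∀ v ∈ (slabGeomIn Φ w₀ R lo hi j ℓs R' r₀ Unear).S x,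
      PathIn G ↑((slabGeomIn Φ w₀ R lo hi j ℓs R' r₀ Unear).S x) ((slabGeomIn Φ w₀ R lo hi j ℓs R' r₀ Unear).y x) v
    simp only [slabGeomIn]
    split_ifs with hnear
    · exact hpath x hx
    · intro v hv; rw [Finset.mem_singleton] at hv; rw [hv, Finset.coe_singleton]
      exact PathIn.refl (Set.mem_singleton _)
  · -- U_adj
    show ∀ u ∈ (slabGeomIn Φ w₀ R lo hi j ℓs R' r₀ Unear).U x, u ∈ (slabGeomIn Φ w₀ R lo hi j ℓs R' r₀ Unear).S x ∨
      ∃ v ∈ (slabGeomIn Φ w₀ R lo hi j ℓs R' r₀ Unear).S x, G.Adj v u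
    simp only [slabGeomIn]
    split_ifs with hnear
    · intro u hu
      obtain ⟨v, hv, hvu⟩ := hU.adj x hx hnear u hu
      exact Or.inr ⟨v, Finset.mem_union_right _ ((mem_cylBallFin Φ).2 hv), hvu⟩
    · intro u hu; exact Or.inl hu
  · -- S_card
    show ((slabGeomIn Φ w₀ R lo hi j ℓs R' r₀ Unear).S x).card ≤ (Φ.Δ + 1) ^ R' + 3
    simp only [slabGeomIn]
    split_ifs with hnear
    · calc ({yv x, y1 x, y2 x} ∪ cylBallFin Φ (tc x) ℓs R').card
          ≤ ({yv x, y1 x, y2 x} : Finset V).card + (cylBallFin Φ (tc x) ℓs R').card := Finset.card_union_le _ _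
        _ ≤ 3 + (Φ.Δ + 1) ^ R' := Nat.add_le_add Finset.card_le_three (card_cylBallFin_le Φ _ ℓs R')
        _ = (Φ.Δ + 1) ^ R' + 3 := Nat.add_comm _ _
    · rw [Finset.card_singleton]; omega
  · -- U_card
    show ((slabGeomIn Φ w₀ R lo hi j ℓs R' r₀ Unear).U x).card ≤ cU
    simp only [slabGeomIn]
    split_ifs with hnear
    · exact hU.card x hx hnear
    · rw [Finset.card_singleton]; exact hU.one_le

end SkelI

end Transplant

end Summit.CriticalPhenomena.PercolationContinuityZ3.Theorems

end
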